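import Mathlib.RingTheory.Valuation.ValuationSubring
import HarnessLib

/-!
# InertiaIsotypicStability — the KEY LEMMA of the two-storey tame cell WITHOUT a cyclotomic-compatibility clause
(decomp-res lens-1 g28 preparation G; NEXT-g29-E §2 STEP A′ — it removes clause (A8) from the cell)

Frame: a field `E`, a valuation ring `O_E ⊆ E`, ring automorphisms of `E`.  An automorphism `t` is INERTIAL when
`v(t y − y) < 1` for all `y ∈ O_E` (it acts trivially on the residue field); an automorphism `g` STABILISES `O_E` when
`y ∈ O_E ↔ g y ∈ O_E`.  Results (all [folklore]; valuation theory of the inertia group, e.g. [Engler–Prestel §5.2–5.3],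
here in elementary form):
* `valuation_lt_valuation_iff` — a stabilising `g` preserves the strict order of values;
  `valuation_apply_eq` — a stabilising `g` OF FINITE ORDER preserves the valuation: `v(g y) = v(y)`.
* `eigenvalue_eq_of_valuation_eq` — RIGIDITY: two eigenvectors of an inertial `t` with the same value have the same
  eigenvalue, provided the eigenvalues lie in a residually injective set `μ ⊆ O_E` (e.g. the `e`-th roots of unity, `e ∈ k×`).
* `isotypic_stability` — THE KEY LEMMA: if `t ∘ g = g ∘ t′` (`t′ = g⁻¹ t g`, normality of the inertia group), `t` inertial,
  `g` value-preserving, and `f ≠ 0` is an eigenvector of `t` and of `t′` with eigenvalues `c`, `c′`, `c, g c′ ∈ μ`,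
then `g f` is a
  `t`-eigenvector with the SAME eigenvalue `c`: `t (g f) = c · g f`.  Hence `g` preserves every isotypic component of an abelian
  tame inertia group — with NO hypothesis relating the conjugation action of `g` on `T` to its action on roots of unity
  (that relation is a CONSEQUENCE: `g c′ = c`).
* `apply_div_eigenvector_fixed`, `valuation_div_eigenvector` — the twisting units `ε := g f / f` are `t`-fixed and have value `1`.
-/

namespace Summit.ResolutionOfSingularities.ResolutionOfSingularities.Theorems.InertiaIsotypicStability

universe u

variable {E : Type u} [Field E] (OE : ValuationSubring E)

/-! ### S1. Stabilising automorphisms preserve the order of values, and (finite order) the valuation -/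

/-- `v a < v b ↔ b/a ∉ O_E` for `a ≠ 0`. [folklore] -/
theorem valuation_lt_iff_div_not_mem {a : E} (ha : a ≠ 0) (b : E) :
    OE.valuation a < OE.valuation b ↔ b / a ∉ OE := by
  have ha' : 0 < OE.valuation a := (Valuation.pos_iff _).mpr ha
  rw [← OE.valuation_le_one_iff, map_div₀, div_le_one₀ ha', not_le]

/-- A stabilising automorphism preserves the strict order of values. [folklore] -/
theorem valuation_lt_valuation_iff {g : E ≃+* E} (hgO : ∀ y, y ∈ OE ↔ g y ∈ OE) (a b : E) :
    OE.valuation (g a) < OE.valuation (g b) ↔ OE.valuation a < OE.valuation b := by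
  by_cases ha : a = 0
  · subst ha
    simp only [map_zero]
    rw [Valuation.pos_iff, Valuation.pos_iff]
    exact (RingEquiv.map_ne_zero_iff g)
  · have hga : g a ≠ 0 := (RingEquiv.map_ne_zero_iff g).mpr ha
    rw [valuation_lt_iff_div_not_mem OE ha, valuation_lt_iff_div_not_mem OE hga, ← map_div₀, ← hgO]

/-- Powers of a stabilising automorphism stabilise. [folklore] -/
theorem mem_iff_pow_apply_mem {g : E ≃+* E} (hgO : ∀ y, y ∈ OE ↔ g y ∈ OE) (k : ℕ) (y : E) :
    y ∈ OE ↔ (g ^ k) y ∈ OE := by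
  induction k generalizing y with
  | zero => exact Iff.rfl
  | succ k ih => rw [pow_succ', RingAut.mul_apply, ← hgO]; exact ih y

/-- A stabilising automorphism OF FINITE ORDER preserves the valuation. [folklore] -/
theorem valuation_apply_eq {g : E ≃+* E} (hgO : ∀ y, y ∈ OE ↔ g y ∈ OE) {n : ℕ} (hn0 : 0 < n)
    (hn : g ^ n = 1) (y : E) : OE.valuation (g y) = OE.valuation y := by
  have hmono : ∀ (k : ℕ) (a b : E), OE.valuation a < OE.valuation b →
      OE.valuation ((g ^ k) a) < OE.valuation ((g ^ k) b) := fun k a b h =>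
    (valuation_lt_valuation_iff OE (mem_iff_pow_apply_mem OE hgO k) a b).mpr h
  have hstep : ∀ k : ℕ, (g ^ k) (g y) = (g ^ (k + 1)) y := fun k => by
    rw [pow_succ, RingAut.mul_apply]
  rcases lt_trichotomy (OE.valuation (g y)) (OE.valuation y) with h | h | h
  · -- decreasing chain `v(g^{k+1} y) < … < v y`, but `g^n = 1`
    have hchain : ∀ k : ℕ, OE.valuation ((g ^ (k + 1)) y) < OE.valuation y := by
      intro k
      induction k with
      | zero => simpa using h
      | succ k ih =>
        have h1 := hmono (k + 1) _ _ h
        rw [hstep] at h1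
        exact h1.trans ih
    have := hchain (n - 1)
    rw [Nat.sub_add_cancel hn0, hn] at this
    exact absurd this (lt_irrefl _)
  · exact h
  · have hchain : ∀ k : ℕ, OE.valuation y < OE.valuation ((g ^ (k + 1)) y) := by
      intro k
      induction k with
      | zero => simpa using h
      | succ k ih =>
        have h1 := hmono (k + 1) _ _ h
        rw [hstep] at h1
        exact ih.trans h1
    have := hchain (n - 1)
    rw [Nat.sub_add_cancel hn0, hn] at this
    exact absurd this (lt_irrefl _)

/-! ### S2. Rigidity of eigenvalues of an inertial automorphism -/

/-- **RIGIDITY.**  Two eigenvectors of an inertial `t` with the same value have the same eigenvalue, when the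
eigenvalues lie in a
residually injective subset `μ ⊆ O_E`. [folklore; Engler–Prestel §5.2] [folklore] -/
theorem eigenvalue_eq_of_valuation_eq {t : E ≃+* E} (ht : ∀ y ∈ OE, OE.valuation (t y - y) < 1)
    {μ : Set E} (hμO : μ ⊆ OE) (hμ : ∀ a ∈ μ, ∀ b ∈ μ, a ≠ b → OE.valuation (a - b) = 1)
    {f f' c c' : E} (hf : f ≠ 0) (hc : c ∈ μ) (hc' : c' ∈ μ) (hc0 : c ≠ 0)
    (htf : t f = c * f) (htf' : t f' = c' * f') (hv : OE.valuation f' = OE.valuation f) : c' = c := by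
  by_contra hne
  have hvf : OE.valuation f ≠ 0 := (Valuation.ne_zero_iff _).mpr hf
  -- `w := f'/f` is a unit of `O_E`
  have hw1 : OE.valuation (f' / f) = 1 := by rw [map_div₀, hv, div_self hvf]
  have hwO : f' / f ∈ OE := (OE.valuation_le_one_iff _).mp hw1.le
  -- `t w - w = ((c' - c)/c) · w`
  have htw : t (f' / f) - f' / f = (c' - c) / c * (f' / f) := by
    rw [map_div₀, htf, htf']
    field_simp
  have hlt := ht _ hwO
  rw [htw, map_mul, hw1, mul_one, map_div₀, hμ c' hc' c hc hne, one_div] at hlt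
  -- `v c ≤ 1` so `(v c)⁻¹ ≥ 1`
  have hvc : OE.valuation c ≤ 1 := (OE.valuation_le_one_iff _).mpr (hμO hc)
  have hvc0 : OE.valuation c ≠ 0 := (Valuation.ne_zero_iff _).mpr hc0
  have : (1 : _) ≤ (OE.valuation c)⁻¹ := one_le_inv_iff₀.mpr ⟨hvc0.bot_lt, hvc⟩
  exact absurd (hlt.trans_le' this) (lt_irrefl _)

/-! ### S3. The key lemma -/

/-- Conjugation transports eigenvectors: `t (g f) = g(c′) · g f` when `t ∘ g = g ∘ t′` and `t′ f = c′ f`. [folklore] -/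
theorem apply_apply_eigenvector {g t t' : E ≃+* E} (hcomm : ∀ y, t (g y) = g (t' y)) {f c' : E}
    (h : t' f = c' * f) : t (g f) = g c' * g f := by
  rw [hcomm, h, map_mul]

/-- **KEY LEMMA (isotypic stability of a tame abelian inertia group).**  `t` inertial, `g` value-preserving with `t
∘ g = g ∘ t′`,
`f ≠ 0` an eigenvector of `t` (eigenvalue `c`) and of `t′` (eigenvalue `c′`), `c, g c′ ∈ μ` residually injective, `c ≠ 0`:
then `g f` is a `t`-eigenvector with the SAME eigenvalue, `t (g f) = c · g f` — and `g c′ = c`. [folklore] -/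
theorem isotypic_stability {g t t' : E ≃+* E} (hgv : ∀ y, OE.valuation (g y) = OE.valuation y)
    (ht : ∀ y ∈ OE, OE.valuation (t y - y) < 1) (hcomm : ∀ y, t (g y) = g (t' y))
    {μ : Set E} (hμO : μ ⊆ OE) (hμ : ∀ a ∈ μ, ∀ b ∈ μ, a ≠ b → OE.valuation (a - b) = 1)
    {f c c' : E} (hf : f ≠ 0) (hc : c ∈ μ) (hgc' : g c' ∈ μ) (hc0 : c ≠ 0)
    (htf : t f = c * f) (ht'f : t' f = c' * f) : g c' = c ∧ t (g f) = c * g f := by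
  have h1 := apply_apply_eigenvector hcomm ht'f
  have h2 : g c' = c :=
    eigenvalue_eq_of_valuation_eq OE ht hμO hμ hf hc hgc' hc0 htf h1 (hgv f)
  exact ⟨h2, by rw [h1, h2]⟩

/-- The twisting unit `ε := g f / f` of an eigenvector is FIXED by `t`. [folklore] -/
theorem apply_div_eigenvector_fixed {g t : E ≃+* E} {f c : E} (hc0 : c ≠ 0)
    (htf : t f = c * f) (htgf : t (g f) = c * g f) : t (g f / f) = g f / f := by
  rw [map_div₀, htf, htgf, mul_div_mul_left _ _ hc0]

/-- The twisting unit has value `1`. [folklore] -/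
theorem valuation_div_eigenvector {g : E ≃+* E} (hgv : ∀ y, OE.valuation (g y) = OE.valuation y)
    {f : E} (hf : f ≠ 0) : OE.valuation (g f / f) = 1 := by
  rw [map_div₀, hgv, div_self ((Valuation.ne_zero_iff _).mpr hf)]

/-- **KEY LEMMA, simultaneous form** for a finite inertial family `T` normalised by `g` (`∀ t ∈ T, ∃ t′ ∈ T, t ∘ g = g ∘ t′`):
a simultaneous `T`-eigenvector `f` with eigenvalues `χ t ∈ μ` (`μ` residually injective and `g`-stable) is mapped by `g` to a
simultaneous eigenvector with the SAME eigenvalues.  This is isotypic stability of the abelian tame inertia group under the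
whole decomposition group, with no cyclotomic-compatibility hypothesis. [folklore] -/
theorem isotypic_stability_finset {g : E ≃+* E} {T : Finset (E ≃+* E)}
    (hgv : ∀ y, OE.valuation (g y) = OE.valuation y) (hT : ∀ t ∈ T, ∀ y ∈ OE, OE.valuation (t y - y) < 1)
    (hnorm : ∀ t ∈ T, ∃ t' ∈ T, ∀ y, t (g y) = g (t' y))
    {μ : Set E} (hμO : μ ⊆ OE) (hμ : ∀ a ∈ μ, ∀ b ∈ μ, a ≠ b → OE.valuation (a - b) = 1)
    (hμg : ∀ a ∈ μ, g a ∈ μ) (hμ0 : (0 : E) ∉ μ)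
    {f : E} (hf : f ≠ 0) {χ : (E ≃+* E) → E} (hχ : ∀ t ∈ T, χ t ∈ μ) (htf : ∀ t ∈ T, t f = χ t * f) :
    ∀ t ∈ T, t (g f) = χ t * g f := by
  intro t ht
  obtain ⟨t', ht', hcomm⟩ := hnorm t ht
  exact (isotypic_stability OE hgv (hT t ht) hcomm hμO hμ hf (hχ t ht) (hμg _ (hχ t' ht'))
    (fun h => hμ0 (h ▸ hχ t ht)) (htf t ht) (htf t' ht')).2

/-- The eigenvalue transport law that REPLACES the cyclotomic-compatibility clause: `g (χ t′) = χ t` whenever `t ∘ g = g ∘ t′`.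
[folklore] -/
theorem apply_eigenvalue_conj_eq {g t t' : E ≃+* E} {T : Finset (E ≃+* E)} (ht : t ∈ T) (ht' : t' ∈ T)
    (hgv : ∀ y, OE.valuation (g y) = OE.valuation y) (hT : ∀ t ∈ T, ∀ y ∈ OE, OE.valuation (t y - y) < 1)
    (hcomm : ∀ y, t (g y) = g (t' y))
    {μ : Set E} (hμO : μ ⊆ OE) (hμ : ∀ a ∈ μ, ∀ b ∈ μ, a ≠ b → OE.valuation (a - b) = 1)
    (hμg : ∀ a ∈ μ, g a ∈ μ) (hμ0 : (0 : E) ∉ μ)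
    {f : E} (hf : f ≠ 0) {χ : (E ≃+* E) → E} (hχ : ∀ t ∈ T, χ t ∈ μ) (htf : ∀ t ∈ T, t f = χ t * f) :
    g (χ t') = χ t :=
  (isotypic_stability OE hgv (hT t ht) hcomm hμO hμ hf (hχ t ht) (hμg _ (hχ t' ht'))
    (fun h => hμ0 (h ▸ hχ t ht)) (htf t ht) (htf t' ht')).1

/-- The twisting unit `ε := g f / f` of a simultaneous eigenvector is fixed by the whole family `T`. [folklore] -/
theorem apply_div_eigenvector_fixed_finset {g : E ≃+* E} {T : Finset (E ≃+* E)}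
    (hgv : ∀ y, OE.valuation (g y) = OE.valuation y) (hT : ∀ t ∈ T, ∀ y ∈ OE, OE.valuation (t y - y) < 1)
    (hnorm : ∀ t ∈ T, ∃ t' ∈ T, ∀ y, t (g y) = g (t' y))
    {μ : Set E} (hμO : μ ⊆ OE) (hμ : ∀ a ∈ μ, ∀ b ∈ μ, a ≠ b → OE.valuation (a - b) = 1)
    (hμg : ∀ a ∈ μ, g a ∈ μ) (hμ0 : (0 : E) ∉ μ)
    {f : E} (hf : f ≠ 0) {χ : (E ≃+* E) → E} (hχ : ∀ t ∈ T, χ t ∈ μ) (htf : ∀ t ∈ T, t f = χ t * f) :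
    ∀ t ∈ T, t (g f / f) = g f / f := fun t ht =>
  apply_div_eigenvector_fixed (fun h => hμ0 (h ▸ hχ t ht)) (htf t ht)
    (isotypic_stability_finset OE hgv hT hnorm hμO hμ hμg hμ0 hf hχ htf t ht)

/-- Roots of unity are residually injective when the nontrivial powers minus one are units: the form in which the cells
carry `ζ` (`v(ζ^k − 1) = 1` for `0 < k < e`). [folklore] -/
theorem valuation_pow_sub_pow_eq_one {ζ : E} {e : ℕ} (hζe : ζ ^ e = 1)
    (hζu : ∀ k : ℕ, 0 < k → k < e → OE.valuation (ζ ^ k - 1) = 1) {a b : ℕ} (ha : a < e) (hb : b < e)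
    (hab : ζ ^ a ≠ ζ ^ b) : OE.valuation (ζ ^ a - ζ ^ b) = 1 := by
  have hζ1 : OE.valuation ζ = 1 := by
    have hepos : 0 < e := lt_of_le_of_lt (Nat.zero_le a) ha
    have h := congrArg OE.valuation hζe
    rw [map_pow, map_one] at h
    exact (pow_eq_one_iff.mp h).resolve_right hepos.ne'
  -- reduce to `a ≤ b` or `b ≤ a`
  wlog hle : b ≤ a generalizing a b
  · have := this hb ha (Ne.symm hab) (not_le.mp hle).le
    rw [← Valuation.map_neg, neg_sub]; exact this
  obtain ⟨k, rfl⟩ := Nat.exists_eq_add_of_le hle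
  have hk0 : 0 < k := by
    rcases Nat.eq_zero_or_pos k with h | h
    · subst h; simp at hab
    · exact h
  have : ζ ^ (b + k) - ζ ^ b = ζ ^ b * (ζ ^ k - 1) := by ring
  rw [this, map_mul, map_pow, hζ1, one_pow, one_mul]
  exact hζu k hk0 (by omega)

end Summit.ResolutionOfSingularities.ResolutionOfSingularities.Theorems.InertiaIsotypicStability
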